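import Mathlib

/-!
# The small-ball lemma of card `binomial-extremal-dart-game` (Hoeffding–Bentkus extremality)

`dartGameSmallBall` : for a finitely supported law `w` on values `X i ∈ [0,1]` with mean
`p = ∑ w i * X i`, the `k`-fold i.i.d. sum satisfies
`P[∑ X < 1] ≤ 2 (1-p)^k + k p (1-p)^(k-1)`.
Proof: Hoeffding–Bentkus binomial extremality in convex order (`sbSum_le_bernoulli`) tested on the
hockey stick `x ↦ max (2 - x) 0`.

Moved from `Cruxes/NoStableSection/SketchIdeator1DartGame.lean` (line `DartGame` of crux
`NoStableSection`, stmt-PneNP-2462), with the four auxiliary definitions (`Ssum`, `bw`, `bX`,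
`hockey`) written out, so that the file declares theorems only:
* `∑ ω : Fin k → Fin N, (∏ r, w (ω r)) * φ (∑ r, X (ω r))` is `E[φ(X_{ω 0} + ⋯ + X_{ω (k-1)})]`
  under the `k`-fold product of the law `w`;
* the Bernoulli(`p`) law is the weight vector `![1 - p, p]` on the values `![0, 1]`;
* the hockey stick at level `c` is `s ↦ max (c - s) 0`.
It is used by the stub `energyBound` (`Theorems/OverlapGapAlgebraNoStableSectionEnergy.lean`).
-/

namespace Summit.PneNP.PneNP.Cruxes.NoStableSection.DartGame
set_option linter.dupNamespace false

open Finset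

variable {N : ℕ}

/-- Peeling off the first coordinate of the `k + 1`-fold product law. -/
theorem sbSum_succ (k : ℕ) (w X : Fin N → ℝ) (φ : ℝ → ℝ) :
    ∑ ω : Fin (k + 1) → Fin N, (∏ r, w (ω r)) * φ (∑ r, X (ω r)) =
      ∑ i : Fin N, w i * ∑ ω : Fin k → Fin N, (∏ r, w (ω r)) * φ (X i + ∑ r, X (ω r)) := by
  rw [← (Fin.consEquiv fun _ => Fin N).sum_comp, Fintype.sum_prod_type]
  refine Finset.sum_congr rfl fun i _ => ?_
  rw [Finset.mul_sum]
  refine Finset.sum_congr rfl fun ω _ => ?_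
  simp only [Fin.consEquiv, Equiv.coe_fn_mk, Fin.prod_univ_succ, Fin.sum_univ_succ, Fin.cons_zero,
    Fin.cons_succ]
  ring

/-- The chord inequality: a convex function lies below its chord over `[c, c+1]`. -/
theorem sb_chord {φ : ℝ → ℝ} (hφ : ConvexOn ℝ Set.univ φ) {x : ℝ} (hx0 : 0 ≤ x) (hx1 : x ≤ 1)
    (c : ℝ) : φ (x + c) ≤ (1 - x) * φ c + x * φ (1 + c) := by
  have h := hφ.2 (Set.mem_univ c) (Set.mem_univ (1 + c)) (sub_nonneg.2 hx1) hx0 (by ring)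
  have heq : (1 - x) • c + x • (1 + c) = x + c := by
    simp only [smul_eq_mul]; ring
  rw [heq] at h
  simpa [smul_eq_mul] using h

/-- Peeling off the first coordinate of the Bernoulli product law. -/
theorem sbBern_succ (k : ℕ) (p : ℝ) (φ : ℝ → ℝ) :
    ∑ ω : Fin (k + 1) → Fin 2, (∏ r, (![1 - p, p] : Fin 2 → ℝ) (ω r)) *
        φ (∑ r, (![(0 : ℝ), 1] : Fin 2 → ℝ) (ω r)) =
      (1 - p) * ∑ ω : Fin k → Fin 2, (∏ r, (![1 - p, p] : Fin 2 → ℝ) (ω r)) *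
          φ (∑ r, (![(0 : ℝ), 1] : Fin 2 → ℝ) (ω r)) +
        p * ∑ ω : Fin k → Fin 2, (∏ r, (![1 - p, p] : Fin 2 → ℝ) (ω r)) *
          φ (1 + ∑ r, (![(0 : ℝ), 1] : Fin 2 → ℝ) (ω r)) := by
  rw [sbSum_succ, Fin.sum_univ_two]
  simp

/-- A translate of a convex function on the line is convex. -/
theorem sb_convexOn_translate {φ : ℝ → ℝ} (hφ : ConvexOn ℝ Set.univ φ) (c : ℝ) :
    ConvexOn ℝ Set.univ (fun s => φ (c + s)) := by
  refine ⟨convex_univ, ?_⟩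
  intro x _ y _ a b ha hb hab
  have h := hφ.2 (Set.mem_univ (c + x)) (Set.mem_univ (c + y)) ha hb hab
  have heq : a • (c + x) + b • (c + y) = c + (a • x + b • y) := by
    simp only [smul_eq_mul]
    rw [show a * (c + x) + b * (c + y) = (a + b) * c + (a * x + b * y) by ring, hab, one_mul]
  rw [heq] at h
  exact h

/-- **Hoeffding–Bentkus extremality (finitary convex order).** Among all laws on `[0,1]` with a
given mean `p`, the Bernoulli(`p`) law maximises `E φ(X₁ + ⋯ + X_k)` for every convex `φ`. -/
theorem sbSum_le_bernoulli (w X : Fin N → ℝ) (hw : ∀ i, 0 ≤ w i) (hw1 : ∑ i, w i = 1)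
    (hX : ∀ i, X i ∈ Set.Icc (0 : ℝ) 1) (k : ℕ) :
    ∀ φ : ℝ → ℝ, ConvexOn ℝ Set.univ φ →
      ∑ ω : Fin k → Fin N, (∏ r, w (ω r)) * φ (∑ r, X (ω r)) ≤
        ∑ ω : Fin k → Fin 2, (∏ r, (![1 - ∑ i, w i * X i, ∑ i, w i * X i] : Fin 2 → ℝ) (ω r)) *
          φ (∑ r, (![(0 : ℝ), 1] : Fin 2 → ℝ) (ω r)) := by
  set p : ℝ := ∑ i, w i * X i with hp
  have hp0 : 0 ≤ p := Finset.sum_nonneg fun i _ => mul_nonneg (hw i) (hX i).1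
  have hp1 : p ≤ 1 := by
    calc p ≤ ∑ i, w i * 1 := Finset.sum_le_sum fun i _ => mul_le_mul_of_nonneg_left (hX i).2 (hw i)
      _ = 1 := by simp [hw1]
  have hbw : ∀ i, 0 ≤ (![1 - p, p] : Fin 2 → ℝ) i := by
    intro i; fin_cases i <;> simp [hp0, hp1]
  induction k with
  | zero => intro φ _; simp
  | succ k ih =>
    intro φ hφ
    calc ∑ ω : Fin (k + 1) → Fin N, (∏ r, w (ω r)) * φ (∑ r, X (ω r))
        = ∑ i, w i * ∑ ω : Fin k → Fin N, (∏ r, w (ω r)) * φ (X i + ∑ r, X (ω r)) :=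
          sbSum_succ k w X φ
      _ ≤ ∑ i, w i * ∑ ω : Fin k → Fin 2, (∏ r, (![1 - p, p] : Fin 2 → ℝ) (ω r)) *
            φ (X i + ∑ r, (![(0 : ℝ), 1] : Fin 2 → ℝ) (ω r)) :=
          Finset.sum_le_sum fun i _ =>
            mul_le_mul_of_nonneg_left (ih (fun s => φ (X i + s)) (sb_convexOn_translate hφ (X i)))
              (hw i)
      _ = ∑ ω : Fin k → Fin 2, (∏ r, (![1 - p, p] : Fin 2 → ℝ) (ω r)) *
            ∑ i, w i * φ (X i + ∑ r, (![(0 : ℝ), 1] : Fin 2 → ℝ) (ω r)) := by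
          simp only [Finset.mul_sum]
          rw [Finset.sum_comm]
          refine Finset.sum_congr rfl fun ω _ => Finset.sum_congr rfl fun i _ => ?_
          ring
      _ ≤ ∑ ω : Fin k → Fin 2, (∏ r, (![1 - p, p] : Fin 2 → ℝ) (ω r)) *
            ((1 - p) * φ (∑ r, (![(0 : ℝ), 1] : Fin 2 → ℝ) (ω r)) +
              p * φ (1 + ∑ r, (![(0 : ℝ), 1] : Fin 2 → ℝ) (ω r))) := by
          refine Finset.sum_le_sum fun ω _ => mul_le_mul_of_nonneg_left ?_
            (Finset.prod_nonneg fun r _ => hbw _)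
          set s : ℝ := ∑ r, (![(0 : ℝ), 1] : Fin 2 → ℝ) (ω r)
          calc ∑ i, w i * φ (X i + s)
              ≤ ∑ i, w i * ((1 - X i) * φ s + X i * φ (1 + s)) :=
                Finset.sum_le_sum fun i _ =>
                  mul_le_mul_of_nonneg_left (sb_chord hφ (hX i).1 (hX i).2 s) (hw i)
            _ = (∑ i, w i) * φ s - (∑ i, w i * X i) * φ s + (∑ i, w i * X i) * φ (1 + s) := by
                simp only [Finset.sum_mul, ← Finset.sum_sub_distrib, ← Finset.sum_add_distrib]
                refine Finset.sum_congr rfl fun i _ => ?_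
                ring
            _ = (1 - p) * φ s + p * φ (1 + s) := by rw [hw1, ← hp]; ring
      _ = (1 - p) * ∑ ω : Fin k → Fin 2, (∏ r, (![1 - p, p] : Fin 2 → ℝ) (ω r)) *
              φ (∑ r, (![(0 : ℝ), 1] : Fin 2 → ℝ) (ω r)) +
            p * ∑ ω : Fin k → Fin 2, (∏ r, (![1 - p, p] : Fin 2 → ℝ) (ω r)) *
              φ (1 + ∑ r, (![(0 : ℝ), 1] : Fin 2 → ℝ) (ω r)) := by
          rw [Finset.mul_sum, Finset.mul_sum, ← Finset.sum_add_distrib]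
          refine Finset.sum_congr rfl fun ω _ => ?_
          ring
      _ = ∑ ω : Fin (k + 1) → Fin 2, (∏ r, (![1 - p, p] : Fin 2 → ℝ) (ω r)) *
            φ (∑ r, (![(0 : ℝ), 1] : Fin 2 → ℝ) (ω r)) := (sbBern_succ k p φ).symm

/-- The hockey stick `x ↦ max (c - x) 0` is convex. -/
theorem sb_convexOn_hockey (c : ℝ) : ConvexOn ℝ Set.univ (fun x : ℝ => max (c - x) 0) := by
  have h1 : ConvexOn ℝ Set.univ (fun x : ℝ => c - x) := by
    refine ⟨convex_univ, ?_⟩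
    intro x _ y _ a b _ _ hab
    simp only [smul_eq_mul]
    have : a * (c - x) + b * (c - y) = (a + b) * c - (a * x + b * y) := by ring
    rw [this, hab, one_mul]
  have h2 : ConvexOn ℝ Set.univ (fun _ : ℝ => (0 : ℝ)) := convexOn_const 0 convex_univ
  exact h1.sup h2

/-- The Bernoulli sums are nonnegative combinations of the values `0, 1`. -/
theorem sbBern_sum_nonneg {k : ℕ} (ω : Fin k → Fin 2) :
    0 ≤ ∑ r, (![(0 : ℝ), 1] : Fin 2 → ℝ) (ω r) :=
  Finset.sum_nonneg fun r _ => by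
    generalize ω r = j
    fin_cases j <;> simp

/-- A hockey stick at a nonpositive level vanishes on the Bernoulli sums. -/
theorem sbHockey_nonpos (k : ℕ) (p : ℝ) {c : ℝ} (hc : c ≤ 0) :
    ∑ ω : Fin k → Fin 2, (∏ r, (![1 - p, p] : Fin 2 → ℝ) (ω r)) *
      max (c - ∑ r, (![(0 : ℝ), 1] : Fin 2 → ℝ) (ω r)) 0 = 0 := by
  refine Finset.sum_eq_zero fun ω _ => ?_
  have hs := sbBern_sum_nonneg ω
  rw [max_eq_right (by linarith), mul_zero]

/-- Peeling off the first Bernoulli coordinate shifts the hockey stick level by one. -/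
theorem sbHockey_succ (k : ℕ) (p c : ℝ) :
    ∑ ω : Fin (k + 1) → Fin 2, (∏ r, (![1 - p, p] : Fin 2 → ℝ) (ω r)) *
        max (c - ∑ r, (![(0 : ℝ), 1] : Fin 2 → ℝ) (ω r)) 0 =
      (1 - p) * ∑ ω : Fin k → Fin 2, (∏ r, (![1 - p, p] : Fin 2 → ℝ) (ω r)) *
          max (c - ∑ r, (![(0 : ℝ), 1] : Fin 2 → ℝ) (ω r)) 0 +
        p * ∑ ω : Fin k → Fin 2, (∏ r, (![1 - p, p] : Fin 2 → ℝ) (ω r)) *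
          max (c - 1 - ∑ r, (![(0 : ℝ), 1] : Fin 2 → ℝ) (ω r)) 0 := by
  have h := sbBern_succ k p (fun s => max (c - s) 0)
  beta_reduce at h
  rw [h]
  congr 1
  congr 1
  refine Finset.sum_congr rfl fun ω _ => ?_
  congr 2
  ring

/-- `E max(1 - Bin(k,p), 0) = (1-p)^k`. -/
theorem sbHockey_one (k : ℕ) (p : ℝ) :
    ∑ ω : Fin k → Fin 2, (∏ r, (![1 - p, p] : Fin 2 → ℝ) (ω r)) *
      max (1 - ∑ r, (![(0 : ℝ), 1] : Fin 2 → ℝ) (ω r)) 0 = (1 - p) ^ k := by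
  induction k with
  | zero => simp
  | succ k ih =>
    rw [sbHockey_succ, ih, show (1 : ℝ) - 1 = 0 by norm_num, sbHockey_nonpos k p le_rfl]
    ring

/-- `E max(2 - Bin(k,p), 0) = 2(1-p)^k + k p (1-p)^(k-1)`. -/
theorem sbHockey_two (k : ℕ) (p : ℝ) :
    ∑ ω : Fin k → Fin 2, (∏ r, (![1 - p, p] : Fin 2 → ℝ) (ω r)) *
      max (2 - ∑ r, (![(0 : ℝ), 1] : Fin 2 → ℝ) (ω r)) 0 =
      2 * (1 - p) ^ k + k * p * (1 - p) ^ (k - 1) := by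
  induction k with
  | zero => simp
  | succ k ih =>
    rw [sbHockey_succ, ih, show (2 : ℝ) - 1 = 1 by norm_num, sbHockey_one]
    cases k with
    | zero => simp; ring
    | succ j =>
      simp only [Nat.add_sub_cancel, pow_succ]
      push_cast
      ring

/-- **The small-ball lemma** (card `binomial-extremal-dart-game`, first lemma): for a law `w` on
values `X i ∈ [0,1]` with mean `p = ∑ w i * X i`,
`P[∑_{r<k} X_{ω r} < 1] ≤ 2(1-p)^k + k p (1-p)^(k-1)` under the `k`-fold product law. -/
theorem dartGameSmallBall (k N : ℕ) (w X : Fin N → ℝ) (hw : ∀ i, 0 ≤ w i) (hw1 : ∑ i, w i = 1)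
    (hX : ∀ i, X i ∈ Set.Icc (0 : ℝ) 1) :
    ∑ ω ∈ (univ : Finset (Fin k → Fin N)).filter (fun ω => ∑ r, X (ω r) < 1), ∏ r, w (ω r) ≤
      2 * (1 - ∑ i, w i * X i) ^ k + k * (∑ i, w i * X i) * (1 - ∑ i, w i * X i) ^ (k - 1) := by
  -- step 1: the indicator of `{s < 1}` lies below the hockey stick at level 2
  have h1 : ∑ ω ∈ (univ : Finset (Fin k → Fin N)).filter (fun ω => ∑ r, X (ω r) < 1), ∏ r, w (ω r)
      ≤ ∑ ω : Fin k → Fin N, (∏ r, w (ω r)) * max (2 - ∑ r, X (ω r)) 0 := by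
    rw [Finset.sum_filter]
    refine Finset.sum_le_sum fun ω _ => ?_
    have hprod : 0 ≤ ∏ r, w (ω r) := Finset.prod_nonneg fun r _ => hw _
    split_ifs with hlt
    · have hm : (1 : ℝ) ≤ max (2 - ∑ r, X (ω r)) 0 := le_max_of_le_left (by linarith)
      nlinarith
    · exact mul_nonneg hprod (le_max_right _ _)
  -- step 2: binomial extremality in convex order
  have h2 := sbSum_le_bernoulli w X hw hw1 hX k (fun s => max (2 - s) 0) (sb_convexOn_hockey 2)
  -- step 3: evaluate the Bernoulli side
  have h3 := sbHockey_two k (∑ i, w i * X i)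
  beta_reduce at h2
  linarith

/-- The ∀-closed form of `dartGameSmallBall`, verbatim the helper stub `stub_dartGameSmallBall`
registered on stmt-PneNP-2462 (line `DartGame`, used by `stub_energyBound`). -/
theorem stub_dartGameSmallBall :
    ∀ (k N : ℕ) (w X : Fin N → ℝ), (∀ i, 0 ≤ w i) → ∑ i, w i = 1 →
      (∀ i, X i ∈ Set.Icc (0 : ℝ) 1) →
      ∑ ω ∈ (Finset.univ : Finset (Fin k → Fin N)).filter (fun ω => ∑ r, X (ω r) < 1),
          ∏ r, w (ω r) ≤
        2 * (1 - ∑ i, w i * X i) ^ k + k * (∑ i, w i * X i) * (1 - ∑ i, w i * X i) ^ (k - 1) :=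
  fun k N w X hw hw1 hX => dartGameSmallBall k N w X hw hw1 hX

/-- The general extremality statement (`BinomialConvexDomination` in Bernoulli product form):
`E φ(∑ X) ≤ E φ(Bin(k, p))` for every convex `φ`, `p` the mean of the law. -/
theorem binomialConvexDomination_productForm (k N : ℕ) (w X : Fin N → ℝ) (φ : ℝ → ℝ)
    (hw : ∀ i, 0 ≤ w i) (hw1 : ∑ i, w i = 1) (hX : ∀ i, X i ∈ Set.Icc (0 : ℝ) 1)
    (hφ : ConvexOn ℝ Set.univ φ) :
    ∑ ω : Fin k → Fin N, (∏ r, w (ω r)) * φ (∑ r, X (ω r)) ≤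
      ∑ ω : Fin k → Fin 2, (∏ r, (![1 - ∑ i, w i * X i, ∑ i, w i * X i] : Fin 2 → ℝ) (ω r)) *
        φ (∑ r, (![(0 : ℝ), 1] : Fin 2 → ℝ) (ω r)) :=
  sbSum_le_bernoulli w X hw hw1 hX k φ hφ

end Summit.PneNP.PneNP.Cruxes.NoStableSection.DartGame
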